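import Summits.QuantumFields.BalabanUV.Beta.D1BFx.RestLegSandwichGradient
import Summits.QuantumFields.BalabanUV.Beta.D1BFx.RestLegContourSumD1

/-!
# `BalabanUV.Beta.D1BFx.RestLegSandwichMixed` — road «BF-x» for binder row D1, slot (K), PART 24 letter **L-B″ («THE SANDWICH REST LEG IS SMOOTH IN BOTH VARIABLES
# AT ONCE: ITS MIXED UNIT SECOND DIFFERENCE GAINS TWO POWERS OF `n`»)**: for the ff block of `B := sandP n (Ga n a) (multM n (2a∕n⁸) 2) = ℋ_R ∘ 𝒬 ∘ Ga`
# (this lineage's «SAND-ENV» `n⁻²·K`, L-B′ «SAND-GRAD» `n⁻³·K′`):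
# **`|B(x + e_ρ, x′ + e_ρ′) − B(x, x′ + e_ρ′) − B(x + e_ρ, x′) + B(x, x′)| ≤ n⁻⁴·K″·e^{−(c∕n)|x − x′|₁}`** with n-free `K″, c`, for every `m` (`n = m + 1`), modulo
# [B5, Prop. 1.2] ∧ [B5, (1.126)–(1.127)] BY NAME (the SAME two displayed hypotheses as «SAND-ENV» ∕ L-B′ ∕ `GluonLegProfileD1`)

HONEST DEPENDENCY (cell records, verbatim): «continuum YM on T⁴ ⇐ BetaPertH ∧ nine spine estimates (0/9 proved); BetaPertH ⇐ (D1) ∧ (D4) ∧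
CAP+tail; G-an2-4 gates asym, D1 and NE2/3/4.»  HONEST FRAMING (cell contract, verbatim): «discharging `BetaPertH` makes Bałaban's UV stability
UNCONDITIONAL — a real constructive-QFT result; it is NOT the continuum limit and NOT the Clay problem.»  THIS MODULE DISCHARGES NOTHING of the
wall: it is VERBATIM the route of L-B′ (`RestLegSandwichGradient.exists_sandP_ff_diff_le`): `sandP = HRp ∘ (Qp ∘ Gp)` is BILINEAR in (the `ℋ_R` column, the `𝒬`-leg of
the fine leg), so the MIXED difference is the sum over the coarse columns `n•y₀` of (the `x`-difference of the `ℋ_R` column `= wH^{(n)}`, `n⁻⁶` by L-h PART 1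
`MinimiserColumnGradient.abs_wH_diff_le`, UNCONDITIONAL) × (the `x′`-difference of the straight-contour sum of the fine leg's column, `n²` by FILE 1∕2 `RestLegContourSumD1` from leaf-04's d1
profile `GluonLegProfileD1.exists_abs_Ga_diff_le_profile` (`kG′·e^{−(δ∕n)‖·‖∞}∕nrm³`) and leaf-04-g9's HLS kit at `p = 3`): `n⁻⁶ · n² = n⁻⁴`.  [folklore] bookkeeping BY NAME;
no `def`, no `def … : Prop`, nothing cited, 0 sorry; the printed statements enter ONLY as the hypotheses `h12 ∧ h126` of the leg letters, never as facts.  WHAT IT IS: the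
letter `β″` («mixed unit second difference») of this seat's `D1BFx/ChargeFreeEnvelopes.osc_mixed_of_unitDiff` ∕ `D1BFx/ChargeFreeBubble.abs_biBubble_le_of_chargeSplit`
(INTENT-1∕-2 [D1LEAF01-G30]) for the smooth leg — the term of the (B,B) rest bubble in which BOTH gains land on ONE leg (W-1 l.50333; OWNER d1-p2 g23 W-g23-14 (b)).
WHAT IT IS NOT: NOT a (1.22) row (R-BB is the OWNER's read-out); 0∕4 row-D1 binders; (K) NOT closed; NOT D1, NOT `BetaPertH`, NOT continuum, NOT Clay.

ABSOLUTE RULE (cell charter, verbatim): «No internally-minted statement may enter as a cited fact. Every hypothesis is either kernel-proved in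
this package or a verbatim quotation of a PUBLISHED theorem with page reference. The manuscript(s) under audit are NOT citable for their own
disputed steps — they are the thing under adjudication; programme-internal (2001/route/tribunal) claims are never citable.»

CONTENT (`n = m + 1`; FILE 1∕2 `RestLegContourSumD1.exists_contourSum_Ga_diff_le` supplies the `x′`-difference of the fine leg's contour sum, `n²`).
* §2 [mod `h12 ∧ h126`] **`exists_sandP_ff_mixed_le`** («SAND-MIXED»: `∃ K″ c, 0 < c ∧ 0 ≤ K″ ∧ ∀ m x x′ κ κ′ ρ ρ′, |B(x+e_ρ, x′+e_ρ′) − B(x, x′+e_ρ′) − B(x+e_ρ, x′) + B(x, x′)|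
  ≤ (n⁴)⁻¹·K″·e^{−(c∕n)|x − x′|₁}` on `(inl κ, inl κ′)`).
* §3 **`exists_decays_blk_sandP_mixed_road`** (the same in block currency: for every `m ρ ρ′` the mixed-difference kernel of the tt block `Decays` with constant `K″∕n⁴` at rate
  `c∕n` — the `hB₁₂` letter shape of `ChargeFreeBubble.abs_biBubble_le_of_chargeSplit`, up to the road's `(−½)•`).
Unit `b2b-balaban-beta-d1-formalise-leaf-01` (gen 30), D1 formalisation swarm LEAF PROVER 01, road «BF-x» («SAND-ENV» lineage gen 20, L-B′ gen 29); INTENT-3 [D1LEAF01-G30-INTENT-3], FILE 2∕2.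
-/

noncomputable section

open Finset
open scoped BigOperators
open Literature.Probability.LatticeModels (Torus.proj)
open Literature.MathematicalPhysics.QuantumFieldTheory.LatticeForm (quo)
open Literature.MathematicalPhysics.QuantumFieldTheory.Balaban1983to89
open Literature.MathematicalPhysics.QuantumFieldTheory.Balaban1983to89.Beta
open B12Sec2to5 (l1 l1_nonneg)
open AffineAveraging (unitVec)
open ExpKernelCalculus (Site MKer Decays comp Zl Zl_pos tsum_exp_shift summable_exp_shift l1_sub_symm l1_sub_triangle)
open PoissonInterior (supNorm)
open KernelSpecInstance (wH l1_le_l1_quo)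
open OneStepResolventKernel (Fib eq_zsmul_quo_of_proj quo_zsmul proj_zsmul)
open VectorTailsLoc (fam kfam)
open Summit.QuantumFields.BalabanUV.Beta.TameKernelCalculus (Spr decays_of_le)
open Summit.QuantumFields.BalabanUV.Beta.D1BFx.PackedKernelSplit (blk)
open Summit.QuantumFields.BalabanUV.Beta.D1BFx.CoarseGramInverse (multM spr_multM)
open Summit.QuantumFields.BalabanUV.Beta.D1BFx.RWeightedLegPack (Gp Qp Cp HRp sandP NlegK NlegRoad Qp_inr_inl NlegK_inl_inr_eq_HRp zsmul_injective spr_HRp spr_Qp spr_Gp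
  NlegRoad_inl_inr_coarse)
open Summit.QuantumFields.BalabanUV.Beta.D1BFx.NlegKHessSplit (HRp_inl_inl)
open Summit.QuantumFields.BalabanUV.Beta.D1BFx.GluonLeg (Ga Ga_symm)
open Summit.QuantumFields.BalabanUV.Beta.D1BFx.GluonLegTails (spr_Ga_of_prop12)
open Summit.QuantumFields.BalabanUV.Beta.D1BFx.RestLegContourSum (comp_Qp_Gp_inr_inl)
open Summit.QuantumFields.BalabanUV.Beta.D1BFx.RestLegContourSumD1 (exists_contourSum_Ga_diff_le)
open Summit.QuantumFields.BalabanUV.Beta.D1BFx.FrozenLegTails (nOf MOf hn1)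
open Summit.QuantumFields.BalabanUV.Beta.D1BFx.RestLegSandwich (l1_le_four_mul_supNormP)
open Summit.QuantumFields.BalabanUV.Beta.D1BFx.RestLegSandwichGradient (summable_compSlice HRp_inl_inr_coarse_eq_wH)
open Summit.QuantumFields.BalabanUV.Beta.D1BFx.MinimiserColumnGradient (abs_wH_diff_le)
open Summit.QuantumFields.BalabanUV.Beta.FP.PeriodicTransportSum (quotOf)
open BlochFibreUniqueness (quo_add_zsmul)
open B5Hk163Strip (kappa163 kappa163_pos)
open B5Hk163TorusHolderDecay (MD163)
open B4TorusKernel (periodConst)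

namespace Summit.QuantumFields.BalabanUV.Beta.D1BFx.RestLegSandwichMixed

/-! ## §2 «SAND-MIXED»: the mixed unit second difference of the sandwich leg's ff block is `O(n⁻⁴)` with scale-`n` decay (mod `h12 ∧ h126`) -/

section Sandwich

variable {a : ℝ} (ha : 0 < a)
include ha

/-- [mod `h12 ∧ h126`] **«SAND-MIXED» — THE SANDWICH LEG's MIXED UNIT SECOND DIFFERENCE IS `O(n⁻⁴)`.**  ONE pair `(K″, c)` such that for EVERY `m` (`n = m + 1`),
all fine points `x x′`, colours `κ κ′` and directions `ρ ρ′`,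
`|B(x + e_ρ, x′ + e_ρ′) − B(x, x′ + e_ρ′) − B(x + e_ρ, x′) + B(x, x′)| ≤ (n⁴)⁻¹·K″·e^{−(c∕n)·|x − x′|₁}` for `B := sandP n (Ga n a) (multM n (2a∕n⁸) 2)` on `(inl κ, inl κ′)`.
PROOF: VERBATIM L-B′ `RestLegSandwichGradient.exists_sandP_ff_diff_le` — `sandP = HRp ∘ (Qp ∘ Gp)` is bilinear in (`ℋ_R` column, `𝒬`-leg), so the mixed difference is the
sum over the coarse columns `n•y₀` of (the `x`-DIFFERENCE of the `ℋ_R` column `= wH(x + e_ρ − n•y₀) − wH(x − n•y₀)`, `≤ n⁻⁶·C₄′·e^{−κ′‖⌊x∕n⌋ − y₀‖∞}` by L-h PART 1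
`abs_wH_diff_le`) × (the `x′`-DIFFERENCE of the contour sum of the fine leg, `≤ n²·KQ′·e^{−(δ∕(2n))‖x′ − n•y₀‖∞}` by §1 `exists_contourSum_Ga_diff_le` — the d1 profile
`nrm⁻³` of `GluonLegProfileD1`); the exponent bookkeeping and the coarse sum `Zl 4 (c₀∕2)` are unchanged; `n⁻⁶·n² = n⁻⁴`. -/
theorem exists_sandP_ff_mixed_le (h12 : B5.Prop12Printed (fam nOf hn1 MOf a ha)) (h126 : B5.Kernel126_127Printed (kfam nOf MOf)) :
    ∃ K c : ℝ, 0 < c ∧ 0 ≤ K ∧ ∀ (m : ℕ) (x x' : Fin 4 → ℤ) (κ κ' ρ ρ' : Fin 4),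
      |sandP (m + 1) (Ga (m + 1) a) (multM (m + 1) (2 * a / ((m + 1 : ℕ) : ℝ) ^ 8) 2) (x + unitVec ρ) (x' + unitVec ρ') (Sum.inl κ) (Sum.inl κ')
        - sandP (m + 1) (Ga (m + 1) a) (multM (m + 1) (2 * a / ((m + 1 : ℕ) : ℝ) ^ 8) 2) x (x' + unitVec ρ') (Sum.inl κ) (Sum.inl κ')
        - sandP (m + 1) (Ga (m + 1) a) (multM (m + 1) (2 * a / ((m + 1 : ℕ) : ℝ) ^ 8) 2) (x + unitVec ρ) x' (Sum.inl κ) (Sum.inl κ')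
        + sandP (m + 1) (Ga (m + 1) a) (multM (m + 1) (2 * a / ((m + 1 : ℕ) : ℝ) ^ 8) 2) x x' (Sum.inl κ) (Sum.inl κ')|
        ≤ ((((m + 1 : ℕ) : ℝ)) ^ 4)⁻¹ * K * Real.exp (-(c / ((m + 1 : ℕ) : ℝ)) * l1 (x - x')) := by
  obtain ⟨KQ, δ, hδ, hKQ, hQ⟩ := exists_contourSum_Ga_diff_le ha h12 h126
  -- the constants of the `ℋ_R` column's GRADIENT (L-h PART 1)
  set κ₁ : ℝ := kappa163 (3 + 1) / (3 + 1) with hκ₁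
  set C₄ : ℝ := MD163 (3 + 1) * periodConst (kappa163 (3 + 1)) 3 with hC₄
  have hκ₁pos : 0 < κ₁ := by rw [hκ₁]; have := kappa163_pos (3 + 1); positivity
  set c₀ : ℝ := min (κ₁ / 4) (δ / 8) with hc₀
  have hc₀pos : 0 < c₀ := lt_min (by positivity) (by positivity)
  have hc₀κ : c₀ ≤ κ₁ / 4 := min_le_left _ _
  have hc₀δ : c₀ ≤ δ / 8 := min_le_right _ _
  -- `C₄ ≥ 0`, read off the gradient letter at one point
  have hC₄nn : 0 ≤ C₄ := by
    have h := abs_wH_diff_le (d := 3) (0 + 1) (Nat.le_add_left 1 0) 0 0 0 0 0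
    have h1 : (0 : ℝ) ≤ ((((0 + 1 : ℕ) : ℝ)) ^ (3 + 3))⁻¹ * (MD163 (3 + 1) * periodConst (kappa163 (3 + 1)) 3) :=
      (mul_nonneg_iff_of_pos_right (Real.exp_pos _)).1 ((abs_nonneg _).trans h)
    simpa using h1
  refine ⟨4 * C₄ * KQ * Real.exp (2 * c₀) * Zl 4 (c₀ / 2), c₀ / 2, half_pos hc₀pos,
    by have := Zl_pos (D := 4) (half_pos hc₀pos); positivity, fun m x x' κ κ' ρ ρ' => ?_⟩
  have hn1 : 1 ≤ m + 1 := Nat.le_add_left 1 m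
  have hnpos : (0 : ℝ) < ((m + 1 : ℕ) : ℝ) := by exact_mod_cast Nat.succ_pos m
  have hn0 : ((m + 1 : ℕ) : ℝ) ≠ 0 := hnpos.ne'
  -- abbreviations
  set Gl : MKer 4 (Fin 4) := Ga (m + 1) a with hGl
  set Cm : MKer 4 (Fin 4) := multM (m + 1) (2 * a / ((m + 1 : ℕ) : ℝ) ^ 8) 2 with hCm
  set QG : MKer 4 (Fib 3) := comp (Qp (m + 1)) (Gp Gl) with hQG
  set g : (Fin 4 → ℤ) → ℝ := fun w =>
    ∑ f : Fib 3, (HRp (m + 1) Gl Cm (x + unitVec ρ) w (Sum.inl κ) f - HRp (m + 1) Gl Cm x w (Sum.inl κ) f)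
      * (QG w (x' + unitVec ρ') f (Sum.inl κ') - QG w x' f (Sum.inl κ')) with hg
  -- Step 0: both composition slices are summable (two decaying kernels at a common rate)
  have hGa : Spr Gl := by
    obtain ⟨C, δ', hδ', h⟩ := spr_Ga_of_prop12 ha h12 h126 (m + 1)
    exact ⟨C, δ', hδ', h⟩
  have hCmS : Spr Cm := by
    obtain ⟨C, δ', hδ', h⟩ := spr_multM (m + 1) (2 * a / ((m + 1 : ℕ) : ℝ) ^ 8) 2
    exact ⟨C, δ', hδ', h⟩
  have hslice : ∀ X X' : Fin 4 → ℤ, Summable fun w : Fin 4 → ℤ => ∑ f : Fib 3, HRp (m + 1) Gl Cm X w (Sum.inl κ) f * QG w X' f (Sum.inl κ') := by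
    intro X X'
    obtain ⟨CH, δH, hδH, hH⟩ := spr_HRp (m + 1) hGa hCmS
    obtain ⟨CQ, δQ, hδQ, hQG'⟩ := ChartConjugationRelative.spr_comp (spr_Qp (m + 1)) (spr_Gp hGa)
    have hmin : 0 < min δH δQ := lt_min hδH hδQ
    exact summable_compSlice (decays_of_le hH (min_le_left _ _)) (decays_of_le hQG' (min_le_right _ _)) hmin X X' (Sum.inl κ) (Sum.inl κ')
  -- Step 1: the mixed second difference of the ff entries is `∑' w, g w`
  have e1 : sandP (m + 1) Gl Cm (x + unitVec ρ) (x' + unitVec ρ') (Sum.inl κ) (Sum.inl κ') - sandP (m + 1) Gl Cm x (x' + unitVec ρ') (Sum.inl κ) (Sum.inl κ')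
      - sandP (m + 1) Gl Cm (x + unitVec ρ) x' (Sum.inl κ) (Sum.inl κ') + sandP (m + 1) Gl Cm x x' (Sum.inl κ) (Sum.inl κ') = ∑' w, g w := by
    show (∑' w, ∑ f : Fib 3, HRp (m + 1) Gl Cm (x + unitVec ρ) w (Sum.inl κ) f * QG w (x' + unitVec ρ') f (Sum.inl κ'))
        - (∑' w, ∑ f : Fib 3, HRp (m + 1) Gl Cm x w (Sum.inl κ) f * QG w (x' + unitVec ρ') f (Sum.inl κ'))
        - (∑' w, ∑ f : Fib 3, HRp (m + 1) Gl Cm (x + unitVec ρ) w (Sum.inl κ) f * QG w x' f (Sum.inl κ'))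
        + (∑' w, ∑ f : Fib 3, HRp (m + 1) Gl Cm x w (Sum.inl κ) f * QG w x' f (Sum.inl κ')) = _
    rw [← (hslice (x + unitVec ρ) (x' + unitVec ρ')).tsum_sub (hslice x (x' + unitVec ρ')),
      ← ((hslice (x + unitVec ρ) (x' + unitVec ρ')).sub (hslice x (x' + unitVec ρ'))).tsum_sub (hslice (x + unitVec ρ) x'),
      ← (((hslice (x + unitVec ρ) (x' + unitVec ρ')).sub (hslice x (x' + unitVec ρ'))).sub (hslice (x + unitVec ρ) x')).tsum_add (hslice x x')]
    refine tsum_congr fun w => ?_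
    simp only [hg]
    rw [← Finset.sum_sub_distrib, ← Finset.sum_sub_distrib, ← Finset.sum_add_distrib]
    exact Finset.sum_congr rfl fun f _ => by ring
  -- Step 2: `g` lives on the sublattice
  have hsupp : Function.support g ⊆ Set.range fun y : Fin 4 → ℤ => (((m + 1 : ℕ) : ℤ)) • y := by
    intro w hw
    by_cases hpw : Torus.proj (m + 1) w = 0
    · exact ⟨quo (m + 1) w, (eq_zsmul_quo_of_proj (N := m + 1) hpw).symm⟩
    · exfalso
      apply hw
      simp only [hg]
      rw [Fintype.sum_sum_type]
      simp only [HRp_inl_inl, sub_self, zero_mul, Finset.sum_const_zero, zero_add, hQG, comp_Qp_Gp_inr_inl, hpw, if_false, mul_zero]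
  have e2 : ∑' w, g w = ∑' y₀ : Fin 4 → ℤ, g ((((m + 1 : ℕ) : ℤ)) • y₀) :=
    (Function.Injective.tsum_eq (zsmul_injective (m + 1)) hsupp).symm
  -- Step 3: the pointwise majorant at a coarse column
  set K₀ : ℝ := ((((m + 1 : ℕ) : ℝ)) ^ 4)⁻¹ * (4 * C₄ * KQ * Real.exp (2 * c₀))
      * Real.exp (-(c₀ / 2 / ((m + 1 : ℕ) : ℝ)) * l1 (x - x')) with hK₀
  have hK₀nn : 0 ≤ K₀ := by positivity
  have hmaj_pt : ∀ y₀ : Fin 4 → ℤ,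
      ‖g ((((m + 1 : ℕ) : ℤ)) • y₀)‖ ≤ K₀ * Real.exp (-(c₀ / 2) * l1 (quotOf (m + 1) x - y₀)) := by
    intro y₀
    rw [Real.norm_eq_abs, hg]
    -- the ff part of the left factor vanishes; the fm part is the DIFFERENCE of the `ℋ_R` column
    have esplit : (∑ f : Fib 3, (HRp (m + 1) Gl Cm (x + unitVec ρ) ((((m + 1 : ℕ) : ℤ)) • y₀) (Sum.inl κ) f
          - HRp (m + 1) Gl Cm x ((((m + 1 : ℕ) : ℤ)) • y₀) (Sum.inl κ) f)
          * (QG ((((m + 1 : ℕ) : ℤ)) • y₀) (x' + unitVec ρ') f (Sum.inl κ') - QG ((((m + 1 : ℕ) : ℤ)) • y₀) x' f (Sum.inl κ')))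
        = ∑ m' : Fin 4, (HRp (m + 1) Gl Cm (x + unitVec ρ) ((((m + 1 : ℕ) : ℤ)) • y₀) (Sum.inl κ) (Sum.inr m')
          - HRp (m + 1) Gl Cm x ((((m + 1 : ℕ) : ℤ)) • y₀) (Sum.inl κ) (Sum.inr m'))
          * (QG ((((m + 1 : ℕ) : ℤ)) • y₀) (x' + unitVec ρ') (Sum.inr m') (Sum.inl κ') - QG ((((m + 1 : ℕ) : ℤ)) • y₀) x' (Sum.inr m') (Sum.inl κ')) := by
      rw [Fintype.sum_sum_type]
      simp only [HRp_inl_inl, sub_self, zero_mul, Finset.sum_const_zero, zero_add]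
    beta_reduce
    rw [esplit]
    -- the two factors
    have hA : ∀ m' : Fin 4, |HRp (m + 1) Gl Cm (x + unitVec ρ) ((((m + 1 : ℕ) : ℤ)) • y₀) (Sum.inl κ) (Sum.inr m')
          - HRp (m + 1) Gl Cm x ((((m + 1 : ℕ) : ℤ)) • y₀) (Sum.inl κ) (Sum.inr m')|
        ≤ ((((m + 1 : ℕ) : ℝ)) ^ (3 + 3))⁻¹ * C₄ * Real.exp (-(κ₁ * B4ContourShift.supNorm (quotOf (m + 1) x - y₀))) := by
      intro m'
      have e₁ := HRp_inl_inr_coarse_eq_wH m ha h12 h126 (x + unitVec ρ) y₀ κ m'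
      have e₀ := HRp_inl_inr_coarse_eq_wH m ha h12 h126 x y₀ κ m'
      have h := abs_wH_diff_le (d := 3) (m + 1) hn1 κ m' ρ x y₀
      rw [hC₄, hκ₁]
      rw [show HRp (m + 1) Gl Cm (x + unitVec ρ) ((((m + 1 : ℕ) : ℤ)) • y₀) (Sum.inl κ) (Sum.inr m')
            = wH (N := m + 1) κ m' (x - ((m + 1 : ℕ) : ℤ) • y₀ + unitVec ρ) from by rw [← add_sub_right_comm]; exact e₁,
        show HRp (m + 1) Gl Cm x ((((m + 1 : ℕ) : ℤ)) • y₀) (Sum.inl κ) (Sum.inr m') = wH (N := m + 1) κ m' (x - ((m + 1 : ℕ) : ℤ) • y₀) from e₀]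
      refine h.trans (le_of_eq ?_)
      ring
    have hB : ∀ m' : Fin 4, |QG ((((m + 1 : ℕ) : ℤ)) • y₀) (x' + unitVec ρ') (Sum.inr m') (Sum.inl κ') - QG ((((m + 1 : ℕ) : ℤ)) • y₀) x' (Sum.inr m') (Sum.inl κ')|
        ≤ (((m + 1 : ℕ) : ℝ)) ^ 2 * KQ * Real.exp (-(δ / 2 / ((m + 1 : ℕ) : ℝ)) * (supNorm (d := 4) (x' - (((m + 1 : ℕ) : ℤ)) • y₀) : ℝ)) := by
      intro m'
      rw [hQG, comp_Qp_Gp_inr_inl, comp_Qp_Gp_inr_inl]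
      simp only [if_pos (proj_zsmul (N := m + 1) y₀), quo_zsmul]
      exact hQ (m + 1) x' y₀ m' κ' ρ'
    -- the exponent bookkeeping (verbatim «SAND-ENV»)
    set T : ℝ := l1 (quotOf (m + 1) x - y₀) with hT
    set U : ℝ := l1 (x' - (((m + 1 : ℕ) : ℤ)) • y₀) with hU
    have hT0 : 0 ≤ T := l1_nonneg _
    have hU0 : 0 ≤ U := l1_nonneg _
    have hS : T ≤ 4 * B4ContourShift.supNorm (quotOf (m + 1) x - y₀) := by
      have h := T4GaugeActionRatePair.l1_le_mul_supNorm (d := 3) (quotOf (m + 1) x - y₀)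
      have e : ((3 : ℕ) : ℝ) + 1 = 4 := by norm_num
      rw [e] at h
      exact h
    have hP : U ≤ 4 * (supNorm (d := 4) (x' - (((m + 1 : ℕ) : ℤ)) • y₀) : ℝ) := l1_le_four_mul_supNormP _
    have htri : l1 (x - x') ≤ ((m + 1 : ℕ) : ℝ) * T + ((m + 1 : ℕ) : ℝ) * 4 + U := by
      have h1 := l1_sub_triangle x ((((m + 1 : ℕ) : ℤ)) • y₀) x'
      have hq : quo (m + 1) (x - (((m + 1 : ℕ) : ℤ)) • y₀) = quotOf (m + 1) x - y₀ := by
        have h := quo_add_zsmul (N := m + 1) x (-y₀)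
        rw [smul_neg, ← sub_eq_add_neg, ← sub_eq_add_neg] at h
        exact h
      have h2 : l1 (x - (((m + 1 : ℕ) : ℤ)) • y₀) ≤ ((m + 1 : ℕ) : ℝ) * T + ((m + 1 : ℕ) : ℝ) * (3 + 1) := by
        have h := l1_le_l1_quo (N := m + 1) (d := 3) (x - (((m + 1 : ℕ) : ℤ)) • y₀)
        rw [hq] at h
        exact_mod_cast h
      have h3 : l1 ((((m + 1 : ℕ) : ℤ)) • y₀ - x') = U := by rw [hU, l1_sub_symm]
      linarith
    have hexp : Real.exp (-(κ₁ * B4ContourShift.supNorm (quotOf (m + 1) x - y₀)))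
          * Real.exp (-(δ / 2 / ((m + 1 : ℕ) : ℝ)) * (supNorm (d := 4) (x' - (((m + 1 : ℕ) : ℤ)) • y₀) : ℝ))
        ≤ Real.exp (2 * c₀) * Real.exp (-(c₀ / 2 / ((m + 1 : ℕ) : ℝ)) * l1 (x - x')) * Real.exp (-(c₀ / 2) * T) := by
      rw [← Real.exp_add, ← Real.exp_add, ← Real.exp_add]
      apply Real.exp_le_exp.2
      have i1 : c₀ * T ≤ κ₁ * B4ContourShift.supNorm (quotOf (m + 1) x - y₀) := by
        have hS0 : 0 ≤ B4ContourShift.supNorm (quotOf (m + 1) x - y₀) := by linarith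
        have h1 : c₀ * T ≤ c₀ * (4 * B4ContourShift.supNorm (quotOf (m + 1) x - y₀)) := mul_le_mul_of_nonneg_left hS (le_of_lt hc₀pos)
        have h2 : c₀ * 4 ≤ κ₁ := by linarith
        nlinarith
      have i2 : c₀ / ((m + 1 : ℕ) : ℝ) * U
          ≤ δ / 2 / ((m + 1 : ℕ) : ℝ) * (supNorm (d := 4) (x' - (((m + 1 : ℕ) : ℤ)) • y₀) : ℝ) := by
        rw [div_mul_eq_mul_div, div_mul_eq_mul_div, div_le_div_iff_of_pos_right hnpos]
        have := mul_le_mul_of_nonneg_left hP (le_of_lt hc₀pos)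
        nlinarith [show (0:ℝ) ≤ (supNorm (d := 4) (x' - (((m + 1 : ℕ) : ℤ)) • y₀) : ℝ) from by positivity]
      have i3 : c₀ / 2 / ((m + 1 : ℕ) : ℝ) * l1 (x - x') ≤ c₀ / 2 * T + 2 * c₀ + c₀ / 2 / ((m + 1 : ℕ) : ℝ) * U := by
        have h := mul_le_mul_of_nonneg_left htri (show 0 ≤ c₀ / 2 / ((m + 1 : ℕ) : ℝ) by positivity)
        have e : c₀ / 2 / ((m + 1 : ℕ) : ℝ) * (((m + 1 : ℕ) : ℝ) * T + ((m + 1 : ℕ) : ℝ) * 4 + U)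
            = c₀ / 2 * T + 2 * c₀ + c₀ / 2 / ((m + 1 : ℕ) : ℝ) * U := by field_simp; ring
        linarith
      have i4 : c₀ / 2 / ((m + 1 : ℕ) : ℝ) * U ≤ c₀ / ((m + 1 : ℕ) : ℝ) * U := by
        have : c₀ / 2 / ((m + 1 : ℕ) : ℝ) ≤ c₀ / ((m + 1 : ℕ) : ℝ) := by
          rw [div_div, div_le_div_iff_of_pos_left hc₀pos (by positivity) hnpos]; linarith
        exact mul_le_mul_of_nonneg_right this hU0
      nlinarith
    -- assemble: `n⁻⁶ · n² = n⁻⁴`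
    have hn6 : ((((m + 1 : ℕ) : ℝ)) ^ (3 + 3))⁻¹ * (((m + 1 : ℕ) : ℝ)) ^ 2 = ((((m + 1 : ℕ) : ℝ)) ^ 4)⁻¹ := by
      field_simp
    calc |∑ m' : Fin 4, (HRp (m + 1) Gl Cm (x + unitVec ρ) ((((m + 1 : ℕ) : ℤ)) • y₀) (Sum.inl κ) (Sum.inr m')
              - HRp (m + 1) Gl Cm x ((((m + 1 : ℕ) : ℤ)) • y₀) (Sum.inl κ) (Sum.inr m'))
            * (QG ((((m + 1 : ℕ) : ℤ)) • y₀) (x' + unitVec ρ') (Sum.inr m') (Sum.inl κ') - QG ((((m + 1 : ℕ) : ℤ)) • y₀) x' (Sum.inr m') (Sum.inl κ'))|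
        ≤ ∑ m' : Fin 4, |HRp (m + 1) Gl Cm (x + unitVec ρ) ((((m + 1 : ℕ) : ℤ)) • y₀) (Sum.inl κ) (Sum.inr m')
              - HRp (m + 1) Gl Cm x ((((m + 1 : ℕ) : ℤ)) • y₀) (Sum.inl κ) (Sum.inr m')|
            * |QG ((((m + 1 : ℕ) : ℤ)) • y₀) (x' + unitVec ρ') (Sum.inr m') (Sum.inl κ') - QG ((((m + 1 : ℕ) : ℤ)) • y₀) x' (Sum.inr m') (Sum.inl κ')| := by
          refine (Finset.abs_sum_le_sum_abs _ _).trans (le_of_eq (Finset.sum_congr rfl fun m' _ => abs_mul _ _))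
      _ ≤ ∑ _m' : Fin 4, (((((m + 1 : ℕ) : ℝ)) ^ (3 + 3))⁻¹ * C₄ * Real.exp (-(κ₁ * B4ContourShift.supNorm (quotOf (m + 1) x - y₀))))
            * ((((m + 1 : ℕ) : ℝ)) ^ 2 * KQ * Real.exp (-(δ / 2 / ((m + 1 : ℕ) : ℝ)) * (supNorm (d := 4) (x' - (((m + 1 : ℕ) : ℤ)) • y₀) : ℝ))) :=
          Finset.sum_le_sum fun m' _ => mul_le_mul (hA m') (hB m') (abs_nonneg _) (by positivity)
      _ = 4 * (((((m + 1 : ℕ) : ℝ) ^ (3 + 3))⁻¹ * ((m + 1 : ℕ) : ℝ) ^ 2) * (C₄ * KQ)) * (Real.exp (-(κ₁ * B4ContourShift.supNorm (quotOf (m + 1) x - y₀))) * Real.exp (-(δ / 2 / ((m + 1 : ℕ) : ℝ)) * (supNorm (d := 4) (x' - ((m + 1 : ℕ) : ℤ) • y₀) : ℝ))) := by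
          rw [Finset.sum_const, Finset.card_univ, Fintype.card_fin, nsmul_eq_mul]; push_cast; ring
      _ ≤ 4 * (((((m + 1 : ℕ) : ℝ) ^ (3 + 3))⁻¹ * ((m + 1 : ℕ) : ℝ) ^ 2) * (C₄ * KQ)) * (Real.exp (2 * c₀) * Real.exp (-(c₀ / 2 / ((m + 1 : ℕ) : ℝ)) * l1 (x - x')) * Real.exp (-(c₀ / 2) * T)) :=
          mul_le_mul_of_nonneg_left hexp (by positivity)
      _ = K₀ * Real.exp (-(c₀ / 2) * T) := by rw [hK₀, ← hn6]; ring
  -- Step 4: sum the majorant over the coarse columns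
  have hsum : Summable fun y₀ : Fin 4 → ℤ => K₀ * Real.exp (-(c₀ / 2) * l1 (quotOf (m + 1) x - y₀)) :=
    (summable_exp_shift (half_pos hc₀pos) (quotOf (m + 1) x)).mul_left K₀
  have hb := tsum_of_norm_bounded hsum.hasSum hmaj_pt
  rw [Real.norm_eq_abs] at hb
  rw [hGl, hCm] at e1
  rw [e1, e2]
  refine hb.trans (le_of_eq ?_)
  rw [tsum_mul_left, tsum_exp_shift, hK₀]
  ring

/-- [mod `h12 ∧ h126`] **«SAND-MIXED» IN BLOCK CURRENCY**: n-free `K″, c > 0` with, for every `m` (`n = m + 1`) and every pair of directions `ρ ρ′`,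
`Decays (fun x x′ κ κ′ ↦ B♭ (x + e_ρ) (x′ + e_ρ′) κ κ′ − B♭ x (x′ + e_ρ′) κ κ′ − B♭ (x + e_ρ) x′ κ κ′ + B♭ x x′ κ κ′) (K″∕n⁴) (c∕n)` for `B♭ := blk (sandP …) true true` —
the `β″` letter (`hB₁₂`) of `ChargeFreeBubble.abs_biBubble_le_of_chargeSplit` for the smooth rest leg (the road's `B := −½(sandP)_tt` scales `K″` by `½`). -/
theorem exists_decays_blk_sandP_mixed_road (h12 : B5.Prop12Printed (fam nOf hn1 MOf a ha)) (h126 : B5.Kernel126_127Printed (kfam nOf MOf)) :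
    ∃ K c : ℝ, 0 < c ∧ 0 ≤ K ∧ ∀ (m : ℕ) (ρ ρ' : Fin 4),
      Decays (fun x x' κ κ' =>
          blk (sandP (m + 1) (Ga (m + 1) a) (multM (m + 1) (2 * a / ((m + 1 : ℕ) : ℝ) ^ 8) 2)) true true (x + unitVec ρ) (x' + unitVec ρ') κ κ'
          - blk (sandP (m + 1) (Ga (m + 1) a) (multM (m + 1) (2 * a / ((m + 1 : ℕ) : ℝ) ^ 8) 2)) true true x (x' + unitVec ρ') κ κ'
          - blk (sandP (m + 1) (Ga (m + 1) a) (multM (m + 1) (2 * a / ((m + 1 : ℕ) : ℝ) ^ 8) 2)) true true (x + unitVec ρ) x' κ κ'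
          + blk (sandP (m + 1) (Ga (m + 1) a) (multM (m + 1) (2 * a / ((m + 1 : ℕ) : ℝ) ^ 8) 2)) true true x x' κ κ')
        (K / (((m + 1 : ℕ) : ℝ)) ^ 4) (c / ((m + 1 : ℕ) : ℝ)) := by
  obtain ⟨K, c, hc, hK, h⟩ := exists_sandP_ff_mixed_le ha h12 h126
  refine ⟨K, c, hc, hK, fun m ρ ρ' x x' κ κ' => ?_⟩
  show |sandP (m + 1) (Ga (m + 1) a) (multM (m + 1) (2 * a / ((m + 1 : ℕ) : ℝ) ^ 8) 2) (x + unitVec ρ) (x' + unitVec ρ') (Sum.inl κ) (Sum.inl κ')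
      - sandP (m + 1) (Ga (m + 1) a) (multM (m + 1) (2 * a / ((m + 1 : ℕ) : ℝ) ^ 8) 2) x (x' + unitVec ρ') (Sum.inl κ) (Sum.inl κ')
      - sandP (m + 1) (Ga (m + 1) a) (multM (m + 1) (2 * a / ((m + 1 : ℕ) : ℝ) ^ 8) 2) (x + unitVec ρ) x' (Sum.inl κ) (Sum.inl κ')
      + sandP (m + 1) (Ga (m + 1) a) (multM (m + 1) (2 * a / ((m + 1 : ℕ) : ℝ) ^ 8) 2) x x' (Sum.inl κ) (Sum.inl κ')| ≤ _
  refine (h m x x' κ κ' ρ ρ').trans (le_of_eq ?_)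
  rw [div_eq_mul_inv K]
  ring

/-- [mod `h12 ∧ h126`] **«SAND-MIXED» IN THE `hB₁₂` LETTER SHAPE** of `ChargeFreeBubble.abs_biBubble_le_of_chargeSplit` (`∀ ρ ρ′ w y a b, |B (w+e_ρ) (y+e_ρ′) a b − B w (y+e_ρ′) a b
− B (w+e_ρ) y a b + B w y a b| ≤ β″·e^{−θ·|w − y|₁}`) for `B := blk (sandP …) true true`, `β″ := K″∕n⁴`, `θ := c∕n`, at every scale. -/
theorem exists_blk_sandP_mixed_letter (h12 : B5.Prop12Printed (fam nOf hn1 MOf a ha)) (h126 : B5.Kernel126_127Printed (kfam nOf MOf)) :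
    ∃ K c : ℝ, 0 < c ∧ 0 ≤ K ∧ ∀ (m : ℕ) (ρ ρ' : Fin 4) (w y : Fin 4 → ℤ) (κ κ' : Fin 4),
      |blk (sandP (m + 1) (Ga (m + 1) a) (multM (m + 1) (2 * a / ((m + 1 : ℕ) : ℝ) ^ 8) 2)) true true (w + unitVec ρ) (y + unitVec ρ') κ κ'
        - blk (sandP (m + 1) (Ga (m + 1) a) (multM (m + 1) (2 * a / ((m + 1 : ℕ) : ℝ) ^ 8) 2)) true true w (y + unitVec ρ') κ κ'
        - blk (sandP (m + 1) (Ga (m + 1) a) (multM (m + 1) (2 * a / ((m + 1 : ℕ) : ℝ) ^ 8) 2)) true true (w + unitVec ρ) y κ κ'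
        + blk (sandP (m + 1) (Ga (m + 1) a) (multM (m + 1) (2 * a / ((m + 1 : ℕ) : ℝ) ^ 8) 2)) true true w y κ κ'|
        ≤ K / (((m + 1 : ℕ) : ℝ)) ^ 4 * Real.exp (-(c / ((m + 1 : ℕ) : ℝ)) * l1 (w - y)) := by
  obtain ⟨K, c, hc, hK, h⟩ := exists_decays_blk_sandP_mixed_road ha h12 h126
  exact ⟨K, c, hc, hK, fun m ρ ρ' w y κ κ' => h m ρ ρ' w y κ κ'⟩

end Sandwich

end Summit.QuantumFields.BalabanUV.Beta.D1BFx.RestLegSandwichMixed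

end
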